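import Summits.QuantumFields.BalabanUV.Beta.AccretiveCombesThomasSandwichSite
import Summits.QuantumFields.BalabanUV.Beta.MultiscaleDistanceMetric

/-!
# `Summit.QuantumFields.BalabanUV.Beta.MultiscaleGrowth` — THE GROWTH CLAUSES OF THE (2.16)-CURRENCY ENDs ARE THEOREMS OF THE
# ADDITIVE GRADING: lattice-ball counting for the scale-adapted distance on the torus cell structure (MODEL; O.2 item (ii) geometry)

HONEST FRAMING (page 1 of everything in this cell).  Discharging `FlowStep.BetaPertH` would make Bałaban's ultraviolet
stability UNCONDITIONAL — a constructive-QFT result; it is NOT the continuum limit and NOT the Clay problem.  This module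
discharges nothing of `BetaPertH`; [folklore] counting, kernel-checked (unit `b2b-balaban-beta-d4-p3`, road P3 «reduction road»,
gen 11; claim «GROWTH-FROM-GRADING», journal 2026-08-20T19:40Z; takes up t4-ne9-formalise-leaf-01-g25's INFO-3 on K4b, C-ne9leaf01g25-1).
HONEST DEPENDENCY: continuum YM on T⁴ ⇐ BetaPertH ∧ nine spine estimates (0/9 proved); BetaPertH ⇐ (D1) ∧ (D4) ∧ CAP+tail;
G-an2-4 gates asym, D1 and NE2/3/4.

WHY THIS FILE.  The (2.16)-currency ENDs of the MODEL decay chain carry, besides the ADDITIVE GRADING datum of beta-d4-p2's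
`MultiscaleDistanceGraded` §4 (`n = L^e`, `|e(x) − e(y)| ≤ A + d_n(x,y)∕R` — the SHAPE of [B6] (2.1)–(2.2)'s step geometry, A = 1 in
print), a second DATA clause of GROWTH type: beta-d4-p2's (ii-c) `MultiscaleDecayRowSums(Add).wrs_inv_levelOp_le(_add)` asks
`#{x′ : d_n(x,x′) < m} ≤ G₀·n(x)^{d₀}·Λ^m` (sites), this lineage's K4b `AccretiveCombesThomasSandwichSiteGrowth.wrs_cellSandwich_levelOp_of_growth`
asks `#{k′ : d_n(t_k,t_{k′}) < m} ≤ N₀·Λ^m` (cells).  THIS FILE PROVES BOTH GROWTH CLAUSES FROM THE GRADING ALONE, on the torus `UT N`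
(this file: the SITE clause; the companion `MultiscaleGrowthCells`: the CELL clause), with constants EXPLICIT in `(d, C_g, c, ε)` — for the
additive datum `C_g = L^A`, `c = log L∕R` — and free of the volume, of the level count and of the top scale:
  §1 (abstract bond structures) every vertex of a walk is within weighted length `wlen` of its start; if all vertices have scale `≤ ν`
     the graph length is `≤ ν·wlen` (`length_le_mul_wlen`); hence `d_n(x,y) < r` and «scale `≤ ν` on the `d_n`-ball of radius `r`» give a
     walk of graph length `< ν·r` (`exists_walk_length_lt`);
  §2 (torus) bonds are unit steps of the sup metric (`B5Leibniz121.dist_up_le`), so `dist ≤ length` and the sup-ball count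
     `B5TorusCover.ballCard_le` applies: **`card_sdist_lt_le`** `#{y : d_n(x,y) < r} ≤ (2⌊C_g·n(x)·e^{cr}·r⌋ + 1)^d` under the graded
     comparison `n(x′) ≤ C_g·n(x)·e^{c·d_n(x,x′)}`;
  §3 the packaged SITE clause **`site_growth`**: `≤ (3C_g)^d·(d!∕ε^d)·n(x)^d·(e^{ε + cd})^m` (`m^d ≤ d!ε^{−d}e^{εm}`, Mathlib
     `Real.pow_div_factorial_le_exp`) — (ii-c)'s shape with `d₀ = d`;
  §4 the SITE clause under the ADDITIVE datum BY NAME (`scale_le_scale_mul_exp_add`): **`site_growth_add`** (`C_g = L^A`, `c = log L∕R`,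
     `Λ_site = e^{ε + d·log L∕R} = e^ε·L^{d∕R}`).
The CELL clause of K4b (`#{k′ : d_n(t_k,t_{k′}) < m} ≤ N₀Λ^m`, the local scale CANCELS) and the ENDs with both clauses discharged are the
companion file `MultiscaleGrowthCells` of this lineage.  The rate condition of (ii-c)'s site END then reads `κ − κ′ > ε + (d+1)·log L∕R`:
level-free, and small exactly when `R ≫ d·log L` — the MODEL form of print's «M sufficiently large» ([B6] (2.2):
`(L^jη)⁻¹dist(Ω^c_j, Ω_{j+1}) > RM`).
WHAT IS NOT HERE: the additive datum itself for a concrete nested region family (DATA; print's (2.1)–(2.2)), Dirichlet holes,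
Bałaban's `Q`∕vector operators, print's sup-norm (3.42).

ABSOLUTE RULE.  Nothing printed is cited as a fact; (2.1)–(2.2) ∕ (2.46) ∕ (2.16) are LOCATORS of shapes on [folklore] declarations.
Row D4: the DATA of the (2.16)-currency MODEL ENDs shrinks from {grading, growth, rate} to {grading, rate}; class of (T3) ∕ NODE O.2 ∕
row D4 UNCHANGED (critical-path width 0); D4 DISCHARGE NO DATE; NOT BetaPertH, NOT continuum, NOT Clay, NOT summit progress.
-/

open scoped BigOperators
open Finset Function

namespace Summit.QuantumFields.BalabanUV.Beta.MultiscaleGrowth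

open Summit.QuantumFields.BalabanUV.Beta.MultiscaleDistance
open Summit.QuantumFields.BalabanUV.Beta.MultiscaleDistanceGraded (reachable_torus scale_le_scale_mul_exp_add)
open Summit.QuantumFields.BalabanUV.Beta.MultiscaleDistanceMetric (sdist_comm sdist_triangle_torus)
open Literature.MathematicalPhysics.QuantumFieldTheory.Balaban1983to89
open Literature.MathematicalPhysics.QuantumFieldTheory.Balaban1983to89.B9Thm37GluePU (bsrc btgt bsrc_apply btgt_apply)
open Literature.MathematicalPhysics.QuantumFieldTheory.Balaban1983to89.B5Leibniz121 (up dist_up_le)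
open B5TorusCover (UT Ctr ctrU ballCard_le_real)

noncomputable section

/-! ## §1 Abstract bond structures: walks inside a `d_n`-ball, graph length against weighted length -/

section Abstract

variable {St Bd : Type} (src tgt : Bd → St) (n : St → ℕ)

/-- Every vertex of a walk is reached from the start of the walk by a walk of no greater weighted length (the prefix).
[folklore] -/
theorem exists_walk_to_support : ∀ {x y : St} (p : (bondGraph src tgt).Walk x y) {z : St}, z ∈ p.support →
    ∃ q : (bondGraph src tgt).Walk x z, wlen src tgt n q ≤ wlen src tgt n p
  | x, _, SimpleGraph.Walk.nil, z, hz => by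
      rw [SimpleGraph.Walk.support_nil, List.mem_singleton] at hz
      subst hz
      exact ⟨SimpleGraph.Walk.nil, le_rfl⟩
  | x, _, SimpleGraph.Walk.cons h p, z, hz => by
      rw [SimpleGraph.Walk.support_cons, List.mem_cons] at hz
      rcases hz with hz | hz
      · subst hz
        exact ⟨SimpleGraph.Walk.nil, by rw [wlen_nil]; exact wlen_nonneg src tgt n _⟩
      · obtain ⟨q, hq⟩ := exists_walk_to_support p hz
        exact ⟨SimpleGraph.Walk.cons h q, by rw [wlen_cons, wlen_cons]; linarith⟩

/-- Hence `d_n(x, z) ≤ wlen(p)` for every vertex `z` of a walk `p` starting at `x`: a walk of weighted length `< r` stays in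
the `d_n`-ball of radius `r` about its start. [folklore] -/
theorem sdist_le_wlen_of_mem_support {x y : St} (p : (bondGraph src tgt).Walk x y) {z : St} (hz : z ∈ p.support) :
    sdist src tgt n x z ≤ wlen src tgt n p := by
  obtain ⟨q, hq⟩ := exists_walk_to_support src tgt n p hz
  exact (sdist_le_wlen src tgt n q).trans hq

/-- **Graph length against weighted length, LOCALLY**: if every vertex of the walk `p` has scale `≤ ν` (`ν > 0`, scales `≥ 1`),
each step costs `≥ 1∕ν`, so `length(p) ≤ ν·wlen(p)` ((K) `length_mul_inv_le_wlen` with the scale cap read on the walk only).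
[folklore] -/
theorem length_le_mul_wlen (hn : ∀ x, 1 ≤ n x) {ν : ℝ} (hν : 0 < ν) :
    ∀ {x y : St} (p : (bondGraph src tgt).Walk x y), (∀ z ∈ p.support, (n z : ℝ) ≤ ν) →
      (p.length : ℝ) ≤ ν * wlen src tgt n p
  | _, _, SimpleGraph.Walk.nil, _ => by simp [wlen_nil]
  | x, y, @SimpleGraph.Walk.cons _ _ _ z _ h p, hsupp => by
      have hx : (n x : ℝ) ≤ ν := hsupp x (by simp)
      have hz : (n z : ℝ) ≤ ν := hsupp z (by simp)
      have ih := length_le_mul_wlen hn hν p fun w hw => hsupp w (by simp [hw])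
      have hstep : 1 ≤ ν * slen n x z := by
        have h1 : ν⁻¹ ≤ slen n x z :=
          le_min (inv_anti₀ (by exact_mod_cast hn x) hx) (inv_anti₀ (by exact_mod_cast hn z) hz)
        calc (1 : ℝ) = ν * ν⁻¹ := (mul_inv_cancel₀ hν.ne').symm
          _ ≤ ν * slen n x z := mul_le_mul_of_nonneg_left h1 hν.le
      rw [SimpleGraph.Walk.length_cons, wlen_cons, Nat.cast_succ, mul_add]
      linarith

/-- For a reachable pair with `d_n(x, y) < r` there is a walk of weighted length `< r` (the infimum is over a nonempty type).
[folklore] -/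
theorem exists_walk_wlen_lt {x y : St} (hxy : (bondGraph src tgt).Reachable x y) {r : ℝ}
    (h : sdist src tgt n x y < r) : ∃ p : (bondGraph src tgt).Walk x y, wlen src tgt n p < r := by
  haveI : Nonempty ((bondGraph src tgt).Walk x y) := hxy
  rw [sdist] at h
  exact exists_lt_of_ciInf_lt h

/-- **THE BALL WALK.**  Scales `≥ 1`; `x, y` reachable with `d_n(x, y) < r`; every site `z` with `d_n(x, z) < r` has scale `≤ ν`
(`ν > 0`).  Then some walk from `x` to `y` has graph length `< ν·r`. [folklore] -/
theorem exists_walk_length_lt (hn : ∀ x, 1 ≤ n x) {x y : St} (hxy : (bondGraph src tgt).Reachable x y) {r ν : ℝ}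
    (hν : 0 < ν) (hball : ∀ z, sdist src tgt n x z < r → (n z : ℝ) ≤ ν) (h : sdist src tgt n x y < r) :
    ∃ p : (bondGraph src tgt).Walk x y, (p.length : ℝ) < ν * r := by
  obtain ⟨p, hp⟩ := exists_walk_wlen_lt src tgt n hxy h
  refine ⟨p, ?_⟩
  have hsupp : ∀ z ∈ p.support, (n z : ℝ) ≤ ν := fun z hz =>
    hball z ((sdist_le_wlen_of_mem_support src tgt n p hz).trans_lt hp)
  exact (length_le_mul_wlen src tgt n hn hν p hsupp).trans_lt (mul_lt_mul_of_pos_left hp hν)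

end Abstract

/-! ## §2 The torus: bonds are unit steps of the sup metric; the `d_n`-ball inside a sup-ball; the raw site count -/

section Torus

variable {d : ℕ} {N : Fin d → ℕ} [∀ i, NeZero (N i)]

/-- A bond of the torus bond structure `(bsrc, btgt)` joins sites at sup-torus distance `≤ 1` (`B5Leibniz121.dist_up_le`).
[folklore] -/
theorem dist_le_one_of_adj {x z : UT N} (h : (bondGraph (bsrc (N := N)) btgt).Adj x z) : dist x z ≤ 1 := by
  rw [bondGraph, SimpleGraph.fromRel_adj] at h
  rcases h.2 with ⟨⟨w, μ⟩, hb1, hb2⟩ | ⟨⟨w, μ⟩, hb1, hb2⟩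
  · simp only [bsrc_apply, btgt_apply] at hb1 hb2
    subst hb1; subst hb2
    exact dist_up_le _ μ
  · simp only [bsrc_apply, btgt_apply] at hb1 hb2
    subst hb1; subst hb2
    rw [dist_comm]
    exact dist_up_le _ μ

/-- The sup-torus distance is at most the graph length of any walk of bonds. [folklore] -/
theorem dist_le_length : ∀ {x y : UT N} (p : (bondGraph (bsrc (N := N)) btgt).Walk x y), dist x y ≤ p.length
  | _, _, SimpleGraph.Walk.nil => by rw [dist_self, SimpleGraph.Walk.length_nil, Nat.cast_zero]
  | x, y, @SimpleGraph.Walk.cons _ _ _ z _ h p => by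
      rw [SimpleGraph.Walk.length_cons, Nat.cast_succ]
      calc dist x y ≤ dist x z + dist z y := dist_triangle _ _ _
        _ ≤ 1 + (p.length : ℝ) := add_le_add (dist_le_one_of_adj h) (dist_le_length p)
        _ = p.length + 1 := add_comm _ _

/-- **Sup-ball counts on `UT N`, uniformly in the periods**: `#{y : dist(x, y) ≤ R} ≤ (2⌊R⌋ + 1)^d` (`B5TorusCover.ballCard_le`
read on the carrier `UT N`). [folklore] -/
theorem card_ball_le (x : UT N) {R : ℝ} (hR : 0 ≤ R) :
    ((univ.filter fun y : UT N => dist x y ≤ R).card : ℝ) ≤ (2 * ⌊R⌋₊ + 1 : ℝ) ^ d := by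
  have h := ballCard_le_real (UT.one_le N) (UT.toSite N x) hR
  refine le_trans ?_ h
  exact_mod_cast Finset.card_le_card_of_injOn (UT.toSite N)
    (fun y hy => by
      rw [Finset.mem_coe, Finset.mem_filter] at hy
      rw [Finset.mem_coe, Finset.mem_filter]
      exact ⟨Finset.mem_univ _, by rw [← UT.dist_eq]; exact hy.2⟩)
    (fun a _ b _ hab => hab)

/-- **THE RAW SITE COUNT.**  On the torus with scales `n ≥ 1` comparing along `d_n` as `n(x′) ≤ C_g·n(x)·e^{c·d_n(x,x′)}`
(`C_g ≥ 1`, `c ≥ 0` — the GRADED comparison shape of (ii-c)), for every `r ≥ 0`: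
`#{y : d_n(x, y) < r} ≤ (2⌊C_g·n(x)·e^{cr}·r⌋ + 1)^d` — the `d_n`-ball lies in the sup-ball of radius `ν·r`, `ν = C_g·n(x)·e^{cr}` the
scale cap on the ball (§1 + `dist_le_length` + `card_ball_le`). [cite: Balaban1984PropagatorsII, (2.46) p.231 + (2.1)-(2.2) p.224] [folklore] -/
theorem card_sdist_lt_le (n : UT N → ℕ) (hn : ∀ x, 1 ≤ n x) {Cg c : ℝ} (hCg : 1 ≤ Cg) (hc : 0 ≤ c)
    (hgr : ∀ x x', (n x' : ℝ) ≤ Cg * n x * Real.exp (c * sdist bsrc btgt n x x')) (x : UT N) {r : ℝ} (hr : 0 ≤ r) :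
    ((univ.filter fun y : UT N => sdist bsrc btgt n x y < r).card : ℝ) ≤
      (2 * ⌊Cg * n x * Real.exp (c * r) * r⌋₊ + 1 : ℝ) ^ d := by
  have hnx : (1 : ℝ) ≤ n x := by exact_mod_cast hn x
  have hν : 0 < Cg * n x * Real.exp (c * r) := by positivity
  have hball : ∀ z, sdist bsrc btgt n x z < r → (n z : ℝ) ≤ Cg * n x * Real.exp (c * r) := fun z hz =>
    (hgr x z).trans (mul_le_mul_of_nonneg_left (Real.exp_le_exp.mpr (mul_le_mul_of_nonneg_left hz.le hc)) (by positivity))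
  have hsub : (univ.filter fun y : UT N => sdist bsrc btgt n x y < r) ⊆
      (univ.filter fun y : UT N => dist x y ≤ Cg * n x * Real.exp (c * r) * r) := by
    intro y hy
    rw [mem_filter] at hy ⊢
    refine ⟨hy.1, ?_⟩
    obtain ⟨p, hp⟩ := exists_walk_length_lt bsrc btgt n hn (reachable_torus x y) hν hball hy.2
    exact (dist_le_length p).trans hp.le
  calc ((univ.filter fun y : UT N => sdist bsrc btgt n x y < r).card : ℝ)
      ≤ ((univ.filter fun y : UT N => dist x y ≤ Cg * n x * Real.exp (c * r) * r).card : ℝ) := by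
        exact_mod_cast card_le_card hsub
    _ ≤ _ := card_ball_le x (mul_nonneg hν.le hr)

/-! ## §3 The packaged SITE clause: polynomial × exponential under one exponential -/

omit [∀ i, NeZero (N i)] in
/-- `m^d ≤ (d!∕ε^d)·e^{εm}` for `m ≥ 0`, `ε > 0` (Mathlib `Real.pow_div_factorial_le_exp` at `εm`). [folklore] -/
theorem pow_le_factorial_div_mul_exp {m : ℝ} (hm : 0 ≤ m) {ε : ℝ} (hε : 0 < ε) (d : ℕ) :
    m ^ d ≤ (d.factorial : ℝ) / ε ^ d * Real.exp (ε * m) := by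
  have h := Real.pow_div_factorial_le_exp (ε * m) (by positivity) d
  have hfac : (0 : ℝ) < d.factorial := by exact_mod_cast Nat.factorial_pos d
  have hεd : 0 < ε ^ d := pow_pos hε d
  rw [mul_pow, div_le_iff₀ hfac] at h
  rw [div_mul_eq_mul_div, le_div_iff₀ hεd]
  calc m ^ d * ε ^ d = ε ^ d * m ^ d := mul_comm _ _
    _ ≤ Real.exp (ε * m) * d.factorial := h
    _ = (d.factorial : ℝ) * Real.exp (ε * m) := mul_comm _ _

omit [∀ i, NeZero (N i)] in
/-- The exponential bookkeeping `(e^{cm})^d·e^{εm} = (e^{ε + cd})^m`. [folklore] -/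
theorem exp_pow_mul_exp_eq (c ε m : ℝ) (d k : ℕ) (hm : (m : ℝ) = k) :
    Real.exp (c * m) ^ d * Real.exp (ε * m) = Real.exp (ε + c * d) ^ k := by
  rw [← Real.exp_nat_mul, ← Real.exp_nat_mul, ← Real.exp_add, hm]
  congr 1
  ring

/-- **SITE GROWTH FROM THE GRADED COMPARISON** — the clause `hgrowth` of beta-d4-p2's
`MultiscaleDecayRowSums.wrs_le_of_entry_decay` ∕ `…Add.wrs_inv_levelOp_le_add` with `d₀ = d`, AS A THEOREM: on the torus with scales
`n ≥ 1` and `n(x′) ≤ C_g·n(x)·e^{c·d_n(x,x′)}` (`C_g ≥ 1`, `c ≥ 0`), for every `ε > 0`, site `x` and `m : ℕ`,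
`#{y : d_n(x, y) < m} ≤ (3C_g)^d·(d!∕ε^d) · n(x)^d · (e^{ε + cd})^m` — `G₀ = (3C_g)^d·d!∕ε^d`, `Λ = e^{ε + cd}`, no volume, no level count.
[cite: Balaban1984PropagatorsII, (2.1)-(2.2) p.224 + (2.46) p.231] [folklore] -/
theorem site_growth (n : UT N → ℕ) (hn : ∀ x, 1 ≤ n x) {Cg c : ℝ} (hCg : 1 ≤ Cg) (hc : 0 ≤ c)
    (hgr : ∀ x x', (n x' : ℝ) ≤ Cg * n x * Real.exp (c * sdist bsrc btgt n x x')) {ε : ℝ} (hε : 0 < ε) (x : UT N) (m : ℕ) :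
    ((univ.filter fun y : UT N => sdist bsrc btgt n x y < m).card : ℝ) ≤
      (3 * Cg) ^ d * ((d.factorial : ℝ) / ε ^ d) * (n x : ℝ) ^ d * Real.exp (ε + c * d) ^ m := by
  have hnx : (1 : ℝ) ≤ n x := by exact_mod_cast hn x
  rcases Nat.eq_zero_or_pos m with hm0 | hm
  · subst hm0
    have h0 : (univ.filter fun y : UT N => sdist bsrc btgt n x y < ((0 : ℕ) : ℝ)) = ∅ := by
      rw [Finset.filter_eq_empty_iff]
      intro y _
      rw [Nat.cast_zero, not_lt]
      exact sdist_nonneg _ _ _ _ _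
    rw [h0, Finset.card_empty, Nat.cast_zero]
    positivity
  · have h1 := card_sdist_lt_le n hn hCg hc hgr x (Nat.cast_nonneg m)
    have hm1 : (1 : ℝ) ≤ m := by exact_mod_cast hm
    have hexp1 : 1 ≤ Real.exp (c * m) := Real.one_le_exp (by positivity)
    have hν1 : 1 ≤ Cg * n x * Real.exp (c * m) := one_le_mul_of_one_le_of_one_le (one_le_mul_of_one_le_of_one_le hCg hnx) hexp1
    have hνm : 1 ≤ Cg * n x * Real.exp (c * m) * m := one_le_mul_of_one_le_of_one_le hν1 hm1
    have hfloor : (2 * ⌊Cg * n x * Real.exp (c * m) * m⌋₊ + 1 : ℝ) ≤ 3 * (Cg * n x * Real.exp (c * m) * m) := by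
      have := Nat.floor_le (by positivity : 0 ≤ Cg * n x * Real.exp (c * m) * m)
      linarith
    have h2 : (2 * ⌊Cg * n x * Real.exp (c * m) * m⌋₊ + 1 : ℝ) ^ d ≤ (3 * (Cg * n x * Real.exp (c * m) * m)) ^ d :=
      pow_le_pow_left₀ (by positivity) hfloor d
    have h3 : (m : ℝ) ^ d ≤ (d.factorial : ℝ) / ε ^ d * Real.exp (ε * m) :=
      pow_le_factorial_div_mul_exp (Nat.cast_nonneg m) hε d
    have hkey := exp_pow_mul_exp_eq c ε m d m rfl
    calc ((univ.filter fun y : UT N => sdist bsrc btgt n x y < m).card : ℝ)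
        ≤ (2 * ⌊Cg * n x * Real.exp (c * m) * m⌋₊ + 1 : ℝ) ^ d := h1
      _ ≤ (3 * (Cg * n x * Real.exp (c * m) * m)) ^ d := h2
      _ = (3 * Cg) ^ d * (n x : ℝ) ^ d * Real.exp (c * m) ^ d * (m : ℝ) ^ d := by ring
      _ ≤ (3 * Cg) ^ d * (n x : ℝ) ^ d * Real.exp (c * m) ^ d * ((d.factorial : ℝ) / ε ^ d * Real.exp (ε * m)) :=
          mul_le_mul_of_nonneg_left h3 (by positivity)
      _ = (3 * Cg) ^ d * ((d.factorial : ℝ) / ε ^ d) * (n x : ℝ) ^ d * (Real.exp (c * m) ^ d * Real.exp (ε * m)) := by ring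
      _ = (3 * Cg) ^ d * ((d.factorial : ℝ) / ε ^ d) * (n x : ℝ) ^ d * Real.exp (ε + c * d) ^ m := by rw [hkey]

end Torus

/-! ## §4 The SITE clause under the ADDITIVE grading datum of `MultiscaleDistanceGraded` §4 (BY NAME) -/

section SiteAdd

open Summit.QuantumFields.BalabanUV.Beta.BoxPoincare (Box)
open Summit.QuantumFields.BalabanUV.Beta.MultiscaleCoerciveTorus (cellPt)
open Summit.QuantumFields.BalabanUV.Beta.MultiscaleDecayBudget (siteScale one_le_siteScale)

variable {d : ℕ} {N : Fin d → ℕ} [∀ i, NeZero (N i)] {J K : Type}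
  (S : J → ℕ) (hS : ∀ l, 1 ≤ S l) (hdivS : ∀ l i, S l ∣ N i) (lvl : K → J) (zc : (k : K) → Ctr N (S (lvl k)))

/-- **SITE GROWTH UNDER THE ADDITIVE GRADING** `n = L^e`, `|e(x) − e(y)| ≤ A + d_n(x,y)∕R` (`L ≥ 1`, `R > 0`): for every `ε > 0`,
`#{x′ : d_n(x, x′) < m} ≤ (3L^A)^d·(d!∕ε^d) · n(x)^d · (e^{ε + d·log L∕R})^m` — beta-d4-p2's `hgrowth` (`d₀ = d`) with
`G₀ = (3L^A)^d·d!∕ε^d`, `Λ = e^ε·L^{d∕R}` (`scale_le_scale_mul_exp_add` BY NAME + `site_growth`).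
[cite: Balaban1984PropagatorsII, (2.1)-(2.2) p.224 + (2.46) p.231] [folklore] -/
theorem site_growth_add
    (hcover : ∀ x : UT N, ∃ k, ∃ v : Box d (S (lvl k)), cellPt S hS hdivS lvl zc k v = x)
    {L : ℕ} (hL : 1 ≤ L) (e : UT N → ℕ) (hne : ∀ x, siteScale S hS hdivS lvl zc hcover x = L ^ e x) {R : ℝ} (hR : 0 < R) {A : ℕ}
    (hadd : ∀ x y : UT N, |(e x : ℝ) - e y| ≤ A + sdist bsrc btgt (siteScale S hS hdivS lvl zc hcover) x y / R)
    {ε : ℝ} (hε : 0 < ε) (x : UT N) (m : ℕ) :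
    ((univ.filter fun x' => sdist bsrc btgt (siteScale S hS hdivS lvl zc hcover) x x' < m).card : ℝ) ≤
      (3 * (L : ℝ) ^ A) ^ d * ((d.factorial : ℝ) / ε ^ d) * (siteScale S hS hdivS lvl zc hcover x : ℝ) ^ d *
        Real.exp (ε + Real.log L / R * d) ^ m :=
  site_growth (siteScale S hS hdivS lvl zc hcover) (one_le_siteScale S hS hdivS lvl zc hcover)
    (one_le_pow₀ (by exact_mod_cast hL)) (div_nonneg (Real.log_nonneg (by exact_mod_cast hL)) hR.le)
    (fun x x' => scale_le_scale_mul_exp_add bsrc btgt _ hL e hne (A := A) (hadd x x')) hε x m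

end SiteAdd

end

end Summit.QuantumFields.BalabanUV.Beta.MultiscaleGrowth
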